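import Mathlib
import Summits.NavierStokesRegularity.NavierStokesRegularity.Theses.EulerZoomLiouville
import Summits.NavierStokesRegularity.NavierStokesRegularity.Theorems.EulerZoomLiouvillePowerGaugeEulerLiouvilleSelfSimilarSwirlBudget
import Summits.NavierStokesRegularity.NavierStokesRegularity.Theorems.EulerZoomLiouvillePowerGaugeEulerLiouvilleNeedleHoveringPast
import Summits.NavierStokesRegularity.NavierStokesRegularity.Theorems.EulerZoomLiouvillePowerGaugeEulerLiouvilleSelfSimilarStrainExcessGrowth
import Summits.NavierStokesRegularity.NavierStokesRegularity.Theorems.EulerZoomLiouvillePowerGaugeEulerLiouvilleSelfSimilarBackwardEscape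
import Summits.NavierStokesRegularity.NavierStokesRegularity.Theorems.EulerZoomLiouvillePowerGaugeEulerLiouvilleSelfSimilarVorticalEscape
import Summits.NavierStokesRegularity.NavierStokesRegularity.Theorems.EulerZoomLiouvillePowerGaugeEulerLiouvilleOutflowDiveHeadGain
import Summits.NavierStokesRegularity.NavierStokesRegularity.Theorems.EulerZoomLiouvillePowerGaugeEulerLiouvilleOutflowDive
import Summits.NavierStokesRegularity.NavierStokesRegularity.Theorems.EulerZoomLiouvillePowerGaugeEulerLiouvilleOutflowDiveSwirlBand
import HarnessLib.Audit

/-!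
# Line `outflow_dive` — OUTFLOW IS NOT A FACE (ideator ns-idea-11 g7, lens «complete» = program-completion; second line)

Crux E `PowerGaugeEulerLiouville` (stmt-NavierStokesRegularity-19832), LEAD skeleton `Lines/birth.lean` v78
(ns-typeII-p2 g12), open stub `Birth.stub_selfSimilarC2Needle` (THE ONE STATEMENT).  Companion of `Lines/needle_faces.lean`
(same seat): there the needle was cut into FACE A (= T1 «swirl» ∪ «fast outflow», symmetry-free) and FACE B (= T2
«pressurised parked tubes»).  This file REMOVES THE OUTFLOW HALF OF FACE A by a class-free, provable ODE lemma:

* `Sig.stub_outflowDive` («NO LONG OUTFLOW DIVES», class-free, plausibly a THEOREM, M/L): for a classical self-similar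
  Euler profile `(V, P′)` with `γ = 1/(2+ρ) < ½`, a rate `c₁ > 0`, a level `h` and a radius `R₁`, every sufficiently far
  point `y` of `{ℋ > h}` with `curl V y ≠ 0` that is a `c₁`-fast OUTFLOW point (`⟪y, W y⟫ ≥ c₁‖y‖²`, `W = γy + V`) comes
  with a point `y′`, `R₁ ≤ ‖y′‖ ≤ ‖y‖`, again vortical and in `{ℋ > h}`, whose radial rate lies in the SWIRL RANGE
  `−c₁‖y′‖² < ⟪y′, W y′⟫ ≤ c₁‖y′‖²`.  Mechanism (the proof a prover should write): follow the BACKWARD orbit `Y′ = −W(Y)`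
  from `y`; while it is `c₁`-fast outflow the radius DEcreases (`(‖Y‖²)′ = −2⟪Y, W Y⟫ ≤ −2c₁‖Y‖²`,
  `BackwardEscape.norm_ge_mul_exp_of_fastOutflow_forward` reversed), so the orbit stays in the compact ball `‖·‖ ≤ ‖y‖`
  and exists; the Bernoulli head grows, `(ℋ∘Y)′ = (1−2γ)‖W‖² ≥ (1−2γ)(⟪Y,W Y⟫/‖Y‖)²` ((3.31),
  `IsSelfSimilarEulerProfile.fderiv_selfSimilarBernoulli_transport`), whence `ℋ(Y σ) − ℋ(y) ≥ ½(1−2γ)c₁(‖y‖² − ‖Y σ‖²)`;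
  if the outflow mode persisted down to radius `R₁` the head would exceed `max_{‖z‖ ≤ R₁} ℋ` once
  `½(1−2γ)c₁(‖y‖² − R₁²) > max_{‖z‖≤R₁} ℋ − h` — so the FIRST exit from the outflow mode happens at a radius `≥ R₁`, at a
  point `y′` with `⟪y′, W y′⟫ = c₁‖y′‖²` (continuity), `ℋ(y′) ≥ ℋ(y) > h`, and `curl V y′ ≠ 0` (vorticity is transported
  along orbits of `W`: the curl of the profile equation is the LINEAR ODE `(W·∇)Ω = (∇V − 1)Ω`, cf. `VorticalEscape`).  Uses `γ < ½` ⇔ `ρ > 0` strictly.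
* `Sig.stub_swirlRangeFace` (FACE A′ = T1 PROPER, OPEN, symmetry-free): under the needle data, for one `ε > 0` and one
  rate `c₁ > 1/((2+ρ)(1+ρ))`, far vortical `ε`-unpressurised points of `{ℋ > h}` are NOT in the swirl range: 
  `−c₁‖y‖² < ⟪y, W y⟫ → c₁‖y‖² < ⟪y, W y⟫`.  (So they are `c₁`-fast inflow or `c₁`-fast outflow; the dive lemma then
  removes outflow.)  This is exactly RESIDUE-MEMO-19832-g12 §2 T1 without an axis — nothing more.
* `Sig.stub_pressureFace` (FACE B = T2, OPEN): verbatim the Prop of `Lines/needle_faces.lean` (same text ⇒ definitionally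
  the same statement; restated because `Cruxes/…/Lines/*.lean` modules are not reliably importable).

PROVED here (no `sorry`): `swirlFace_of_dive : outflowDive → swirlRangeFace → pressureFace → swirlFace` (FACE A of
`needle_faces` follows — OUTFLOW IS NOT A FACE), `selfSimilarC2Needle_of_swirlFace : swirlFace → pressureFace → needle`,
and the audit form `selfSimilarC2Needle_of : outflowDive → swirlRangeFace → pressureFace → Sig.stub_selfSimilarC2Needle`.
Net effect with `needle_faces`: THE ONE STATEMENT ⇐ (T1 proper ∧ T2) and ⇐ («needle parks» ∧ T2); the outflow stratum
and the channel/parking bookkeeping are discharged by logic + one ODE lemma.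
DENT on the crux: 0 (no stub of `birth.lean` is closed; one new PROVABLE lemma is isolated for provers).
REV 2 (g7): the dive lemma is itself a kernel-checked composition `outflowDive_of : stub_outflowExit (D1, ODE exit) →
`stub_headGain` (D2, calculus) → `stub_vorticityTransport` (D3, linear transport) → `Sig.stub_outflowDive` over explicit `C¹` orbit arcs;
sorries = B, A′, D1, D2, D3.  REV 3: tree names of (3.31) and of the vorticity-transport identity (3.3) ⇒ (3.4) cited in the D2/D3 docstrings (V68 P1).
REV 4: the ODE layer for D1 (cut-off field `Loc.exists_cutoff_local`, global orbit `C2.Kelvin.hasDerivAt_flow_neg`, template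
`Loc.volume_vortical_confined_eq_zero`) and the half-orbit identity for D2 (`HalfOrbit.bernoulli_comp_sub_eq_of_Ici`) cited by tree name; decls unchanged.
REV 5 (WIRING): D2 is CLOSED BY NAME — `stub_headGain := …Theorems.PowerGaugeEulerLiouville.OutflowDive.headGain` (width seat ns-ezl-w1 g5,
p664656 ACCEPTED, `Theorems/EulerZoomLiouvillePowerGaugeEulerLiouvilleOutflowDiveHeadGain.lean`, statement = `Sig.stub_headGain` verbatim); sorries 5 → 4
(B, A′, D1, D3).  D3 (`…OutflowDiveVorticityTransport`, ns-ezl-w1 g5 p664894) and D1 (`OutflowDive.exists_outflowExit`, LEAD ns-typeII-p2 g13) are announced;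
they get wired the same way when ACCEPTED.  Decls unchanged.
REV 6 (WIRING, 21:05Z): D1 `stub_outflowExit := OutflowDive.exists_outflowExit` (LEAD ns-typeII-p2 g13, `Theorems/…OutflowDiveExit.lean`) and
D3 `stub_vorticityTransport := OutflowDive.vorticityTransport` (ns-ezl-w1 g5 p664894) are CLOSED BY NAME; hence `stub_outflowDive` («NO LONG OUTFLOW
DIVES») is CLOSED via this line's `outflowDive_of`, and independently via the LEAD's assembly `OutflowDive.outflowDive` (`stub_outflowDive'`).
Sorries 4 → 2 = FACE B `stub_pressureFace` (T2) and FACE A′ `stub_swirlRangeFace` (T1 proper) — the two residual faces this line NAMES and does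
NOT claim (crux idea «ballistic-faces»: A′ is not easier than T2; the believed shape is A″ «swirl has a pressurised past»).  Decls unchanged.
REV 7 (21:20Z): + the sorry-free COROLLARY `swirlBand_of_not_channel` («THE NEEDLE LIVES IN THE SWIRL BAND»): for every C² profile with
ρ ∈ (0,½], ¬HasFastVorticalChannel ⇒ ∀ c₁ > 1/((2+ρ)(1+ρ)) ∃ profile pressure P′ ∃ h, beyond every radius a Bernoulli-high vortical point with
−c₁‖y‖² < ⟪y,W y⟫ ≤ c₁‖y‖² — ¬channel's outflow witnesses are converted by the (closed) Dive; axioms standard.  TAKEABLE as a Theorems corollary over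
`Birth.HasFastVorticalChannel` spelled out.  No new stub; decls of record unchanged.
REV 8 (21:45Z, after v83 REGISTERED): `HasFastVorticalChannel` re-copied VERBATIM from `Lines/birth.lean` v83 (threshold `0 < c₁` — «ANY FAST CHANNEL
KILLS», LEAD g13); the needle text is character-identical to v83; compositions bridged by `c₁ > 1/((2+ρ)(1+ρ)) ⇒ c₁ > 0` (faces A/A′ keep their
own written-out rate); the corollaries are now BY NAME (ns-ezl-w3 g5 p669403 `…OutflowDiveSwirlBand.lean`): `swirlBand_of_not_channel` (any rate
c₁ > 0) and `slowBand_of_not_channel` («the needle lives in the SLOW band»).  D1–D3 / Dive texts untouched (FREEZE).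
REV 9 (22:20Z, `Lines/birth.lean` v85 in the tree): `HasFastVorticalChannel` re-copied VERBATIM from v85 = THREE killed senses (any-rate inflow channel ∨
inflow half-band deficit ∨ virial form); needle text + all copied predicates character-identical to v85 (script-checked); bridges now `Or.inl ⟨c₁, …⟩`
(resp. `fun h => hV (Or.inl h)` for the by-name corollaries); nothing else changed.
REV 10 (22:45Z, `Lines/birth.lean` ★ v86 c942a8e28728 registered 22:33Z): `HasFastVorticalChannel` re-copied VERBATIM from v86 = FIVE killed senses; needle +
all copied predicates character-identical to v86 (script-checked); bridges unchanged (`Or.inl`); stub texts unchanged.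
REV 11 (g8, 23:06Z, `Lines/birth.lean` ★ v87 sha256:9ccebdd516bb in the tree, 2172 l.): `HasFastVorticalChannel` re-copied VERBATIM from v87 = SEVEN killed senses
(v86's five + (6) absolute virial form, ns-ezl-w1 g6 p674543 + (7) decaying floor `a ≥ a₀/‖y‖²`, LEAD g13); all other copied predicates untouched and
character-identical to v87 (script `recopy_v87.py`); bridges unchanged (`Or.inl`); stub texts unchanged; no new mathematics in this revision.
REV 12 (g8, 23:30Z, `Lines/birth.lean` ★ v89 commit 7176ac66e19c sha16 83158934bc1e25e0, 2205 l.): `HasFastVorticalChannel` (NINE senses: + (8) absolute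
radial-pressure form, ns-sfl-p1 g6; + (9) rpow power band, ns-ezl-w1 g6) AND `HasResidenceClock` (SIX alternatives: + (6) v88 LOCAL power clock, LEAD g13)
re-copied VERBATIM from v89 (script `recopy_v89.py`; all 9 shared predicates character-identical, `identity_check.py`); bridges unchanged (`Or.inl`); stub
texts unchanged; no new mathematics in this revision.
No summit is proved by a line; the crux is OPEN; NS regularity is NOT proved.
-/

open MeasureTheory Set Filter Topology Metric
open scoped ENNReal NNReal ContDiff

set_option linter.dupNamespace false

namespace Summit.NavierStokesRegularity.NavierStokesRegularity.Cruxes.PowerGaugeEulerLiouville.OutflowDive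

/-- Local abbreviation: ℝ³ (verbatim `Birth.E3`). -/
abbrev E3 : Type := EuclideanSpace ℝ (Fin 3)

/-- Membership in Seregin's power-gauged ancient Euler class (verbatim `Birth.InClass`, `Lines/birth.lean` v78). -/
@[reducible] def InClass (ρ : ℝ) (u : ℝ → E3 → E3) (p : ℝ → E3 → ℝ) (H : ℝ → E3 → E3 →L[ℝ] E3)
    (c : ℝ≥0) : Prop :=
  Literature.Analysis.FluidPDE.IsSuitableWeakSolutionOn
      (Literature.Analysis.FluidPDE.slab (EuclideanSpace ℝ (Fin 3)) (Set.Iio 0) isOpen_Iio) 0 0 u p ∧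
    Literature.Analysis.FluidPDE.HasWeakSpatialGradientOn
      (Literature.Analysis.FluidPDE.slab (EuclideanSpace ℝ (Fin 3)) (Set.Iio 0) isOpen_Iio) u H ∧
    (∀ a : ℝ, 0 < a →
      ENNReal.ofReal (a ^ (2 * ρ)) * Literature.Analysis.FluidPDE.cknA a (0 : ℝ × E3) u +
          ENNReal.ofReal (a ^ ρ) * Literature.Analysis.FluidPDE.cknE a (0 : ℝ × E3) H +
        ENNReal.ofReal (a ^ (2 * ρ)) * Literature.Analysis.FluidPDE.cknD a (0 : ℝ × E3) p ≤ (c : ℝ≥0∞))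

/-- Exactly self-similar member about the origin with profile `(V, P)` (verbatim `Birth.IsExactlySelfSimilar`, v78). -/
@[reducible] def IsExactlySelfSimilar (ρ : ℝ) (u : ℝ → E3 → E3) (p : ℝ → E3 → ℝ) (V : E3 → E3) (P : E3 → ℝ) :
    Prop :=
  (∀ τ : ℝ, τ < 0 → u τ = Literature.Analysis.FluidPDE.selfSimilarCollapse (1 / (2 + ρ)) 0 V τ) ∧
    (∀ τ : ℝ, τ < 0 → p τ = Literature.Analysis.FluidPDE.selfSimilarCollapsePressure (1 / (2 + ρ)) 0 P τ)

/-- EXTREMAL profile: the `A`-gauge rate is saturated (verbatim `Birth.IsExtremalProfile`, v78). -/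
@[reducible] def IsExtremalProfile (ρ : ℝ) (V : E3 → E3) : Prop :=
  ∃ ε : ℝ, 0 < ε ∧ ∃ L₀ : ℝ, ∀ L : ℝ, L₀ ≤ L →
    ε ≤ L ^ (2 * ρ - 1) * ∫ y in Metric.ball (0 : E3) L, ‖V y‖ ^ 2

/-- Bernoulli piercing on spheres beyond every radius (verbatim `Birth.HasBernoulliPiercing`, v78). -/
@[reducible] def HasBernoulliPiercing (ρ : ℝ) (V : E3 → E3) : Prop :=
  ∀ P' : E3 → ℝ, Literature.Analysis.FluidPDE.IsSelfSimilarEulerProfile (1 / (2 + ρ)) 0 V P' →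
    ∀ h R₀ : ℝ, ∃ R : ℝ, R₀ ≤ R ∧ ∀ y : E3, ‖y‖ = R →
      inner ℝ y (V y) ≤ -(1 / (2 + ρ) * ‖y‖ ^ 2) →
        (Literature.Analysis.FluidPDE.curl V y = 0 ∨
          Literature.Analysis.FluidPDE.selfSimilarBernoulli (1 / (2 + ρ)) 0 V P' y < h)

/-- FAST VORTICAL CHANNEL in one of NINE killed senses (verbatim `Birth.HasFastVorticalChannel`, ★ v89): (1) ONE-SIDED inflow channel at ANY rate
`c₁ > 0` (v83, LEAD g13 `…vorticalChannelC2_profile_anyRate`); (2) INFLOW HALF-BAND DEFICIT (v84, LEAD g13 `…inflowBandDeficitC2_profile`); (3) VIRIAL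
FORM (v85, ns-ezl-w1 g6 `…virialDeficitC2_profile`); (4) ABSOLUTE INFLOW-BAND DEFICIT «any inward drift kills» (v86, LEAD g13 p674010
`…absBandDeficitC2_profile`, POWER clock); (5) the h-FREE RADIAL-PRESSURE FORM (v86, ns-sfl-p1 g6 `…radialPressureDeficitC2_profile`); (6) ABSOLUTE
VIRIAL form of (4) (v87, ns-ezl-w1 g6 p674543 `…absVirialDeficitC2_profile`); (7) = (4) with the DECAYING floor `a ≥ a₀/‖y‖²` (v87, LEAD g13
`…decayingBandDeficitC2_profile`); (8) ABSOLUTE RADIAL-PRESSURE FORM (v89, ns-sfl-p1 g6 `…absRadialPressureDeficitC2_profile`); (9) rpow POWER BAND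
`0 ≤ e₁ < ρ`, `0 ≤ e₂ < 2+ρ+e₁` (v89, ns-ezl-w1 g6 `…powerBandDeficitC2_profile`: the swirl face is circular to order `‖y‖^{−1−ρ+0}` and centripetally
balanced to order `‖y‖^{−2−2ρ+0}`). -/
@[reducible] def HasFastVorticalChannel (ρ : ℝ) (V : E3 → E3) : Prop :=
  (∃ c₁ : ℝ, 0 < c₁ ∧
    ∀ P' : E3 → ℝ, Literature.Analysis.FluidPDE.IsSelfSimilarEulerProfile (1 / (2 + ρ)) 0 V P' →
      ∀ h : ℝ, ∃ R₀ : ℝ, ∀ y : E3, R₀ ≤ ‖y‖ → h < Literature.Analysis.FluidPDE.selfSimilarBernoulli (1 / (2 + ρ)) 0 V P' y →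
        Literature.Analysis.FluidPDE.curl V y ≠ 0 →
          inner ℝ y (Literature.Analysis.FluidPDE.selfSimilarTransport (1 / (2 + ρ)) 0 V y) ≤ -(c₁ * ‖y‖ ^ 2)) ∨
  (∃ c₁ μ : ℝ, 0 < c₁ ∧ 0 < μ ∧
    ∀ P' : E3 → ℝ, Literature.Analysis.FluidPDE.IsSelfSimilarEulerProfile (1 / (2 + ρ)) 0 V P' →
      ∀ h : ℝ, ∃ R₀ : ℝ, ∀ y : E3, R₀ ≤ ‖y‖ → h < Literature.Analysis.FluidPDE.selfSimilarBernoulli (1 / (2 + ρ)) 0 V P' y →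
        Literature.Analysis.FluidPDE.curl V y ≠ 0 →
          -(c₁ * ‖y‖ ^ 2) ≤ inner ℝ y (Literature.Analysis.FluidPDE.selfSimilarTransport (1 / (2 + ρ)) 0 V y) →
          inner ℝ y (Literature.Analysis.FluidPDE.selfSimilarTransport (1 / (2 + ρ)) 0 V y) ≤ 0 →
          (2 * c₁ ^ 2 + μ) * ‖y‖ ^ 2 ≤ ‖Literature.Analysis.FluidPDE.selfSimilarTransport (1 / (2 + ρ)) 0 V y‖ ^ 2 +
            (1 / (2 + ρ)) * inner ℝ y (Literature.Analysis.FluidPDE.selfSimilarTransport (1 / (2 + ρ)) 0 V y) +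
            inner ℝ y (fderiv ℝ V y (Literature.Analysis.FluidPDE.selfSimilarTransport (1 / (2 + ρ)) 0 V y))) ∨
  (∃ c₁ μ : ℝ, 0 < c₁ ∧ 0 < μ ∧
    ∀ P' : E3 → ℝ, Literature.Analysis.FluidPDE.IsSelfSimilarEulerProfile (1 / (2 + ρ)) 0 V P' →
      ∀ h : ℝ, ∃ R₀ : ℝ, ∀ y : E3, R₀ ≤ ‖y‖ → h < Literature.Analysis.FluidPDE.selfSimilarBernoulli (1 / (2 + ρ)) 0 V P' y →
        Literature.Analysis.FluidPDE.curl V y ≠ 0 →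
          -(c₁ * ‖y‖ ^ 2) ≤ inner ℝ y (Literature.Analysis.FluidPDE.selfSimilarTransport (1 / (2 + ρ)) 0 V y) →
          inner ℝ y (Literature.Analysis.FluidPDE.selfSimilarTransport (1 / (2 + ρ)) 0 V y) ≤ 0 →
          2 * P' y + inner ℝ y (gradient P' y) ≤ 2 * h + (2 * (1 / (2 + ρ)) * (1 - 1 / (2 + ρ)) - 2 * c₁ ^ 2 - μ) * ‖y‖ ^ 2) ∨
  (∃ κb a₀ : ℝ, 0 < κb ∧ 0 < a₀ ∧
    ∀ P' : E3 → ℝ, Literature.Analysis.FluidPDE.IsSelfSimilarEulerProfile (1 / (2 + ρ)) 0 V P' →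
      ∀ h : ℝ, ∃ R₀ : ℝ, ∀ y : E3, R₀ ≤ ‖y‖ → h < Literature.Analysis.FluidPDE.selfSimilarBernoulli (1 / (2 + ρ)) 0 V P' y →
        Literature.Analysis.FluidPDE.curl V y ≠ 0 →
          -κb ≤ inner ℝ y (Literature.Analysis.FluidPDE.selfSimilarTransport (1 / (2 + ρ)) 0 V y) →
          inner ℝ y (Literature.Analysis.FluidPDE.selfSimilarTransport (1 / (2 + ρ)) 0 V y) ≤ 0 →
          a₀ ≤ ‖Literature.Analysis.FluidPDE.selfSimilarTransport (1 / (2 + ρ)) 0 V y‖ ^ 2 +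
            (1 / (2 + ρ)) * inner ℝ y (Literature.Analysis.FluidPDE.selfSimilarTransport (1 / (2 + ρ)) 0 V y) +
            inner ℝ y (fderiv ℝ V y (Literature.Analysis.FluidPDE.selfSimilarTransport (1 / (2 + ρ)) 0 V y))) ∨
  (∃ c₁ μ : ℝ, 0 < c₁ ∧ 0 < μ ∧
    ∀ P' : E3 → ℝ, Literature.Analysis.FluidPDE.IsSelfSimilarEulerProfile (1 / (2 + ρ)) 0 V P' →
      ∀ h : ℝ, ∃ R₀ : ℝ, ∀ y : E3, R₀ ≤ ‖y‖ → h < Literature.Analysis.FluidPDE.selfSimilarBernoulli (1 / (2 + ρ)) 0 V P' y →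
        Literature.Analysis.FluidPDE.curl V y ≠ 0 →
          -(c₁ * ‖y‖ ^ 2) ≤ inner ℝ y (Literature.Analysis.FluidPDE.selfSimilarTransport (1 / (2 + ρ)) 0 V y) →
          inner ℝ y (Literature.Analysis.FluidPDE.selfSimilarTransport (1 / (2 + ρ)) 0 V y) ≤ 0 →
          inner ℝ y (gradient P' y) ≤ ‖Literature.Analysis.FluidPDE.selfSimilarTransport (1 / (2 + ρ)) 0 V y‖ ^ 2 +
            ((1 / (2 + ρ)) * (1 - 1 / (2 + ρ)) - 2 * c₁ ^ 2 - μ) * ‖y‖ ^ 2) ∨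
  (∃ κb a₀ : ℝ, 0 < κb ∧ 0 < a₀ ∧
    ∀ P' : E3 → ℝ, Literature.Analysis.FluidPDE.IsSelfSimilarEulerProfile (1 / (2 + ρ)) 0 V P' →
      ∀ h : ℝ, ∃ R₀ : ℝ, ∀ y : E3, R₀ ≤ ‖y‖ → h < Literature.Analysis.FluidPDE.selfSimilarBernoulli (1 / (2 + ρ)) 0 V P' y →
        Literature.Analysis.FluidPDE.curl V y ≠ 0 →
          -κb ≤ inner ℝ y (Literature.Analysis.FluidPDE.selfSimilarTransport (1 / (2 + ρ)) 0 V y) →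
          inner ℝ y (Literature.Analysis.FluidPDE.selfSimilarTransport (1 / (2 + ρ)) 0 V y) ≤ 0 →
          2 * P' y + inner ℝ y (gradient P' y) ≤ 2 * h + 2 * (1 / (2 + ρ)) * (1 - 1 / (2 + ρ)) * ‖y‖ ^ 2 - a₀) ∨
  (∃ κb a₀ : ℝ, 0 < κb ∧ 0 < a₀ ∧
    ∀ P' : E3 → ℝ, Literature.Analysis.FluidPDE.IsSelfSimilarEulerProfile (1 / (2 + ρ)) 0 V P' →
      ∀ h : ℝ, ∃ R₀ : ℝ, ∀ y : E3, R₀ ≤ ‖y‖ → h < Literature.Analysis.FluidPDE.selfSimilarBernoulli (1 / (2 + ρ)) 0 V P' y →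
        Literature.Analysis.FluidPDE.curl V y ≠ 0 →
          -κb ≤ inner ℝ y (Literature.Analysis.FluidPDE.selfSimilarTransport (1 / (2 + ρ)) 0 V y) →
          inner ℝ y (Literature.Analysis.FluidPDE.selfSimilarTransport (1 / (2 + ρ)) 0 V y) ≤ 0 →
          a₀ / ‖y‖ ^ 2 ≤ ‖Literature.Analysis.FluidPDE.selfSimilarTransport (1 / (2 + ρ)) 0 V y‖ ^ 2 +
            (1 / (2 + ρ)) * inner ℝ y (Literature.Analysis.FluidPDE.selfSimilarTransport (1 / (2 + ρ)) 0 V y) +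
            inner ℝ y (fderiv ℝ V y (Literature.Analysis.FluidPDE.selfSimilarTransport (1 / (2 + ρ)) 0 V y))) ∨
  (∃ κb a₀ : ℝ, 0 < κb ∧ 0 < a₀ ∧
    ∀ P' : E3 → ℝ, Literature.Analysis.FluidPDE.IsSelfSimilarEulerProfile (1 / (2 + ρ)) 0 V P' →
      ∀ h : ℝ, ∃ R₀ : ℝ, ∀ y : E3, R₀ ≤ ‖y‖ → h < Literature.Analysis.FluidPDE.selfSimilarBernoulli (1 / (2 + ρ)) 0 V P' y →
        Literature.Analysis.FluidPDE.curl V y ≠ 0 →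
          -κb ≤ inner ℝ y (Literature.Analysis.FluidPDE.selfSimilarTransport (1 / (2 + ρ)) 0 V y) → inner ℝ y (Literature.Analysis.FluidPDE.selfSimilarTransport (1 / (2 + ρ)) 0 V y) ≤ 0 →
          inner ℝ y (gradient P' y) ≤ ‖Literature.Analysis.FluidPDE.selfSimilarTransport (1 / (2 + ρ)) 0 V y‖ ^ 2 +
            (1 / (2 + ρ)) * (1 - 1 / (2 + ρ)) * ‖y‖ ^ 2 - a₀) ∨
  (∃ κb a₀ e₁ e₂ : ℝ, 0 < κb ∧ 0 < a₀ ∧ 0 ≤ e₁ ∧ e₁ < ρ ∧ 0 ≤ e₂ ∧ e₂ < 2 + ρ + e₁ ∧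
    ∀ P' : E3 → ℝ, Literature.Analysis.FluidPDE.IsSelfSimilarEulerProfile (1 / (2 + ρ)) 0 V P' →
      ∀ h : ℝ, ∃ R₀ : ℝ, ∀ y : E3, R₀ ≤ ‖y‖ → h < Literature.Analysis.FluidPDE.selfSimilarBernoulli (1 / (2 + ρ)) 0 V P' y →
        Literature.Analysis.FluidPDE.curl V y ≠ 0 →
          -(κb * ‖y‖ ^ (-e₁)) ≤ inner ℝ y (Literature.Analysis.FluidPDE.selfSimilarTransport (1 / (2 + ρ)) 0 V y) → inner ℝ y (Literature.Analysis.FluidPDE.selfSimilarTransport (1 / (2 + ρ)) 0 V y) ≤ 0 →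
          a₀ * ‖y‖ ^ (-e₂) ≤ ‖Literature.Analysis.FluidPDE.selfSimilarTransport (1 / (2 + ρ)) 0 V y‖ ^ 2 +
            (1 / (2 + ρ)) * inner ℝ y (Literature.Analysis.FluidPDE.selfSimilarTransport (1 / (2 + ρ)) 0 V y) +
            inner ℝ y (fderiv ℝ V y (Literature.Analysis.FluidPDE.selfSimilarTransport (1 / (2 + ρ)) 0 V y)))

/-- Residence clock, SIX alternatives (verbatim `Birth.HasResidenceClock`, ★ v88/v89): (1) LOG clock, (2) POWER clock `c′R^{2+ρ}`, (3)/(4) subcritical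
strain clocks, (5) the HOVERING LAW with Bernoulli oscillation exponent `θ_ℋ < 2+ρ`, (6) v88 LOCAL power clock — for every `c′ > 0` ONE ball, centre
arbitrary (LEAD g13 `NeedleRace.selfSimilar_ae_eq_zero_of_localPowerClockC2`). -/
@[reducible] def HasResidenceClock (ρ : ℝ) (V : E3 → E3) : Prop :=
  (∃ s₁ : ℝ, 0 ≤ s₁ ∧ ∀ x₀ : E3, Literature.Analysis.FluidPDE.curl V x₀ ≠ 0 → ∃ r : ℝ, 0 < r ∧ ∃ R₀ : ℝ, ∀ R : ℝ, R₀ ≤ R →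
      ∀ (V' : E3 → E3) (K Rbig : ℝ), ContDiff ℝ 2 V' → (∀ y, ‖fderiv ℝ V' y‖ ≤ K) → 2 * R < Rbig →
        (∀ w ∈ Metric.ball (0 : E3) Rbig, V' w = V w) →
        (volume (Metric.ball x₀ r ∩ {y | ∀ σ ∈ Set.Icc 0 (s₁ * Real.log R),
          ‖Literature.Analysis.ODE.evolutionMap (fun _ : ℝ => Literature.Analysis.FluidPDE.selfSimilarTransport (1 / (2 + ρ)) 0 V') 0 (-σ) y‖ ≤ 2 * R})).toReal ≤
          (volume (Metric.ball x₀ r)).toReal / 2) ∨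
  (∀ c' : ℝ, 0 < c' → ∀ x₀ : E3, Literature.Analysis.FluidPDE.curl V x₀ ≠ 0 → ∃ r : ℝ, 0 < r ∧ ∃ R₀ : ℝ, ∀ R : ℝ, R₀ ≤ R →
      ∀ (V' : E3 → E3) (K Rbig : ℝ), ContDiff ℝ 2 V' → (∀ y, ‖fderiv ℝ V' y‖ ≤ K) → 2 * R < Rbig →
        (∀ w ∈ Metric.ball (0 : E3) Rbig, V' w = V w) →
        (volume (Metric.ball x₀ r ∩ {y | ∀ σ ∈ Set.Icc 0 (c' * R ^ (2 + ρ)),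
          ‖Literature.Analysis.ODE.evolutionMap (fun _ : ℝ => Literature.Analysis.FluidPDE.selfSimilarTransport (1 / (2 + ρ)) 0 V') 0 (-σ) y‖ ≤ 2 * R})).toReal ≤
          (volume (Metric.ball x₀ r)).toReal / 2) ∨
  (∃ s : ℝ, s < 1 ∧ (∀ z v : E3, inner ℝ (fderiv ℝ V z v) v ≤ s * ‖v‖ ^ 2) ∧
    ∀ ε : ℝ, 0 < ε → ∃ R₂ : ℝ, ∀ z : E3, R₂ ≤ ‖z‖ → Real.log ‖Literature.Analysis.FluidPDE.curl V z‖ ≤ ε * ‖z‖ ^ (2 + ρ)) ∨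
  (∃ s : ℝ, s < (1 + 2 * ρ) / (2 * (2 + ρ)) ∧ ∀ z v : E3, inner ℝ (fderiv ℝ V z v) v ≤ s * ‖v‖ ^ 2) ∨
  (∃ θ : ℝ, θ < 2 + ρ ∧
    (∀ P' : E3 → ℝ, Literature.Analysis.FluidPDE.IsSelfSimilarEulerProfile (1 / (2 + ρ)) 0 V P' →
      ∃ C : ℝ, ∀ r : ℝ, 1 ≤ r → ∀ y y' : E3, ‖y‖ ≤ r → ‖y'‖ ≤ r →
        Literature.Analysis.FluidPDE.selfSimilarBernoulli (1 / (2 + ρ)) 0 V P' y - Literature.Analysis.FluidPDE.selfSimilarBernoulli (1 / (2 + ρ)) 0 V P' y' ≤ C * r ^ θ) ∧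
    ∀ c' : ℝ, 0 < c' → ∀ x₀ : E3, Literature.Analysis.FluidPDE.curl V x₀ ≠ 0 → ∃ r : ℝ, 0 < r ∧ ∃ R₀ : ℝ,
      ∀ R : ℝ, R₀ ≤ R → ∀ (V' : E3 → E3) (K Rbig : ℝ), ContDiff ℝ 2 V' →
        (∀ y, ‖fderiv ℝ V' y‖ ≤ K) → 2 * R < Rbig → (∀ w ∈ Metric.ball (0 : E3) Rbig, V' w = V w) →
        (volume (Metric.ball x₀ r ∩ {a | ∀ σ ∈ Set.Icc 0 (c' * R ^ (2 + ρ)), ‖Literature.Analysis.ODE.evolutionMap (fun _ : ℝ => Literature.Analysis.FluidPDE.selfSimilarTransport (1 / (2 + ρ)) 0 V') 0 (-σ) a‖ ≤ 2 * R} ∩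
          {a | c' * R ^ (2 + ρ) / 2 ≤ (volume {σ ∈ Set.Icc 0 (c' * R ^ (2 + ρ)) |
            ‖Literature.Analysis.FluidPDE.selfSimilarTransport (1 / (2 + ρ)) 0 V' (Literature.Analysis.ODE.evolutionMap (fun _ : ℝ => Literature.Analysis.FluidPDE.selfSimilarTransport (1 / (2 + ρ)) 0 V') 0 (-σ) a)‖ < R ^ (-((2 + ρ - θ) / 4))}).toReal})).toReal ≤
          (volume (Metric.ball x₀ r)).toReal / 4) ∨
  (∀ c' : ℝ, 0 < c' → ∃ x₀ : E3, ∃ r : ℝ, 0 < r ∧ ∃ R₀ : ℝ, ∀ R : ℝ, R₀ ≤ R →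
      ∀ (V' : E3 → E3) (K Rbig : ℝ), ContDiff ℝ 2 V' → (∀ y, ‖fderiv ℝ V' y‖ ≤ K) → 2 * R < Rbig →
        (∀ w ∈ Metric.ball (0 : E3) Rbig, V' w = V w) →
        (volume (Metric.ball x₀ r ∩ {y | ∀ σ ∈ Set.Icc 0 (c' * R ^ (2 + ρ)),
          ‖Literature.Analysis.ODE.evolutionMap (fun _ : ℝ => Literature.Analysis.FluidPDE.selfSimilarTransport (1 / (2 + ρ)) 0 V') 0 (-σ) y‖ ≤ 2 * R})).toReal ≤
          (volume (Metric.ball x₀ r)).toReal / 2)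

/-- Bounded vortical Bernoulli levels + unpressurised vortical far field (verbatim `Birth.HasVorticalBernoulliBound`, v52/v78). -/
@[reducible] def HasVorticalBernoulliBound (ρ : ℝ) (V : E3 → E3) : Prop :=
  ∀ P' : E3 → ℝ, Literature.Analysis.FluidPDE.IsSelfSimilarEulerProfile (1 / (2 + ρ)) 0 V P' →
    (∃ Mb : ℝ, ∀ y : E3, Literature.Analysis.FluidPDE.curl V y ≠ 0 →
        Literature.Analysis.FluidPDE.selfSimilarBernoulli (1 / (2 + ρ)) 0 V P' y ≤ Mb) ∧
    (∃ ε R₀ : ℝ, ε < (1 / (2 + ρ)) * (1 - 1 / (2 + ρ)) / 2 ∧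
        ∀ y : E3, R₀ ≤ ‖y‖ → Literature.Analysis.FluidPDE.curl V y ≠ 0 → P' y ≤ ε * ‖y‖ ^ 2)

/-- Tame vortical Bernoulli levels, growth form (verbatim `Birth.HasTameVorticalBernoulli`, v78). -/
@[reducible] def HasTameVorticalBernoulli (ρ : ℝ) (V : E3 → E3) : Prop :=
  HasVorticalBernoulliBound ρ V ∨
    ((∀ P' : E3 → ℝ, Literature.Analysis.FluidPDE.IsSelfSimilarEulerProfile (1 / (2 + ρ)) 0 V P' →
        ∃ Mb : ℝ, ∀ y : E3, Literature.Analysis.FluidPDE.curl V y ≠ 0 → Literature.Analysis.FluidPDE.selfSimilarBernoulli (1 / (2 + ρ)) 0 V P' y ≤ Mb) ∧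
      (∃ A q R₀ : ℝ, 0 ≤ A ∧ 0 ≤ q ∧ q < 2 + 2 * (1 + 2 * ρ) / 3 ∧
        ∀ z : E3, R₀ ≤ ‖z‖ → Literature.Analysis.FluidPDE.frobeniusNormSq (fderiv ℝ V z) - ‖Literature.Analysis.FluidPDE.curl V z‖ ^ 2 ≤ A * ‖z‖ ^ q))

/-- THE ONE STATEMENT — verbatim `Birth.Sig.stub_selfSimilarC2Needle` (`Lines/birth.lean` v78, open stub of the LEAD skeleton); over the verbatim predicate copies above it is definitionally the LEAD's needle (`Iff.rfl` once both files are in scope). -/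
def Sig.stub_selfSimilarC2Needle : Prop :=
  ∀ ρ : ℝ, 0 < ρ → ρ ≤ 1 / 2 →
    ∀ (u : ℝ → E3 → E3) (p : ℝ → E3 → ℝ) (H : ℝ → E3 → E3 →L[ℝ] E3) (c : ℝ≥0) (V : E3 → E3) (P : E3 → ℝ),
      InClass ρ u p H c → IsExactlySelfSimilar ρ u p V P → IsExtremalProfile ρ V → ContDiff ℝ 2 V →
        ¬ HasBernoulliPiercing ρ V → ¬ HasTameVorticalBernoulli ρ V → ¬ HasFastVorticalChannel ρ V → ¬ HasResidenceClock ρ V →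
        ¬ (∃ R : E3 ≃ₗᵢ[ℝ] E3, Literature.Analysis.FluidPDE.IsAxisymmetric (fun y => R (V (R.symm y)))) →
        Function.uncurry u =ᵐ[volume.restrict (Set.Iio (0 : ℝ) ×ˢ (Set.univ : Set E3))] 0


/-- THE NEEDLE DATA: every hypothesis of `Birth.Sig.stub_selfSimilarC2Needle` EXCEPT the channel binder
`¬ HasFastVorticalChannel ρ V`, bundled (verbatim predicates of `Lines/birth.lean` v78). -/
@[reducible] def NeedleData (ρ : ℝ) (u : ℝ → E3 → E3) (p : ℝ → E3 → ℝ) (H : ℝ → E3 → E3 →L[ℝ] E3)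
    (c : ℝ≥0) (V : E3 → E3) (P : E3 → ℝ) : Prop :=
  InClass ρ u p H c ∧ IsExactlySelfSimilar ρ u p V P ∧ IsExtremalProfile ρ V ∧ ContDiff ℝ 2 V ∧
    ¬ HasBernoulliPiercing ρ V ∧ ¬ HasTameVorticalBernoulli ρ V ∧ ¬ HasResidenceClock ρ V ∧
    ¬ (∃ R : E3 ≃ₗᵢ[ℝ] E3, Literature.Analysis.FluidPDE.IsAxisymmetric (fun y => R (V (R.symm y))))


/-- Signature of `stub_pressureFace` (FACE B = T2, OPEN) — VERBATIM the Prop `NeedleFaces.Sig.stub_pressureFace` of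
`Lines/needle_faces.lean`: under the needle data, for EVERY `ε > 0`, every classical pressure `P′` of `V` and every
level `h` there is `R₀` beyond which every VORTICAL point of `{ℋ_{P′} > h}` is unpressurised, `P′ y ≤ ε‖y‖²`.
Why it might fail: jet stagnation heads (`W = 0`, `P′ ≈ ½γ(1−γ)R² + h`, cross-section `≲ R^{−1−ρ}`) are locally
budget-consistent (W8 D2-FEASIBILITY; this seat's `Ideas/starting-jet-needle.md`); the kill must be global. -/
def Sig.stub_pressureFace : Prop :=
  ∀ ρ : ℝ, 0 < ρ → ρ ≤ 1 / 2 →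
    ∀ (u : ℝ → E3 → E3) (p : ℝ → E3 → ℝ) (H : ℝ → E3 → E3 →L[ℝ] E3) (c : ℝ≥0) (V : E3 → E3) (P : E3 → ℝ),
      NeedleData ρ u p H c V P →
        ∀ ε : ℝ, 0 < ε →
          ∀ P' : E3 → ℝ, Literature.Analysis.FluidPDE.IsSelfSimilarEulerProfile (1 / (2 + ρ)) 0 V P' →
            ∀ h : ℝ, ∃ R₀ : ℝ, ∀ y : E3, R₀ ≤ ‖y‖ →
              h < Literature.Analysis.FluidPDE.selfSimilarBernoulli (1 / (2 + ρ)) 0 V P' y →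
                Literature.Analysis.FluidPDE.curl V y ≠ 0 → P' y ≤ ε * ‖y‖ ^ 2

/-- Signature of `stub_outflowDive` («NO LONG OUTFLOW DIVES», CLASS-FREE — no `InClass`, no budgets, no needle data):
for `ρ ∈ (0, ½]` (`γ = 1/(2+ρ) < ½`), a classical self-similar Euler profile `(V, P′)` about `0`, a rate `c₁ > 0`, a
level `h` and a radius `R₁`, there is `R₂` such that every point `y` with `‖y‖ ≥ R₂`, `ℋ y > h`, `curl V y ≠ 0` and
`⟪y, W y⟫ ≥ c₁‖y‖²` (fast OUTFLOW) admits a point `y′` with `R₁ ≤ ‖y′‖ ≤ ‖y‖`, `ℋ y′ > h`, `curl V y′ ≠ 0` and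
`−c₁‖y′‖² < ⟪y′, W y′⟫ ≤ c₁‖y′‖²` (swirl range).  Proof route in the module docstring (backward orbit, radial
Grönwall, head gain `½(1−2γ)c₁(‖y‖² − ‖Y‖²)` against `max_{‖z‖≤R₁} ℋ`, first exit by continuity, vorticity transport).
Why it might fail: only through an ODE technicality (existence of the backward orbit up to the first exit — it stays
in the compact ball `‖·‖ ≤ ‖y‖`, and `V ∈ C²`); the statement is believed TRUE.  Size M/L (flow of a `C²` field on a
compact set: Mathlib Picard–Lindelöf / `Literature.Analysis.ODE.evolutionMap` on a cut-off copy as in `Birth.HasResidenceClock`). -/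
def Sig.stub_outflowDive : Prop :=
  ∀ ρ : ℝ, 0 < ρ → ρ ≤ 1 / 2 →
    ∀ (V : E3 → E3) (P' : E3 → ℝ), Literature.Analysis.FluidPDE.IsSelfSimilarEulerProfile (1 / (2 + ρ)) 0 V P' →
      ∀ c₁ : ℝ, 0 < c₁ → ∀ h R₁ : ℝ, ∃ R₂ : ℝ, ∀ y : E3, R₂ ≤ ‖y‖ →
        h < Literature.Analysis.FluidPDE.selfSimilarBernoulli (1 / (2 + ρ)) 0 V P' y →
          Literature.Analysis.FluidPDE.curl V y ≠ 0 →
            c₁ * ‖y‖ ^ 2 ≤ inner ℝ y (Literature.Analysis.FluidPDE.selfSimilarTransport (1 / (2 + ρ)) 0 V y) →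
              ∃ y' : E3, R₁ ≤ ‖y'‖ ∧ ‖y'‖ ≤ ‖y‖ ∧
                h < Literature.Analysis.FluidPDE.selfSimilarBernoulli (1 / (2 + ρ)) 0 V P' y' ∧
                  Literature.Analysis.FluidPDE.curl V y' ≠ 0 ∧
                    -(c₁ * ‖y'‖ ^ 2) < inner ℝ y' (Literature.Analysis.FluidPDE.selfSimilarTransport (1 / (2 + ρ)) 0 V y') ∧
                      inner ℝ y' (Literature.Analysis.FluidPDE.selfSimilarTransport (1 / (2 + ρ)) 0 V y') ≤ c₁ * ‖y'‖ ^ 2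

/-- Signature of `stub_swirlRangeFace` (FACE A′ = T1 PROPER, OPEN, symmetry-free): under the needle data there are ONE
`ε > 0` and ONE rate `c₁ > 1/((2+ρ)(1+ρ))` such that, for every classical pressure `P′` and level `h`, beyond some `R₀`
no vortical `ε`-unpressurised point of `{ℋ_{P′} > h}` has its radial rate in the swirl range: `−c₁‖y‖² < ⟪y, W y⟫`
forces `c₁‖y‖² < ⟪y, W y⟫`.  Informal: such a point has `‖W‖² > (γ(1−γ) − 2ε)‖y‖² + 2h`, so in the swirl range its
TANGENTIAL speed is `≥ √(γ(1−γ) − 2ε − c₁²)·‖y‖` — the symmetry-free T1 residue of RESIDUE-MEMO-19832-g12 §2 (the v76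
axis binder removes only axisymmetric profiles; ns-ezl-w3 g4: «T1 without symmetry not reached»).  Why it might fail:
thin spiral jets of pitch `s̄ ∈ (1−γ, γ/(1−γ))` are budget- and Bernoulli-consistent at the order-of-magnitude level and
the similarity friction `(1−2γ)‖W‖²` makes swirl episodes transient, not absent (`Ideas/starting-jet-needle.md`). -/
def Sig.stub_swirlRangeFace : Prop :=
  ∀ ρ : ℝ, 0 < ρ → ρ ≤ 1 / 2 →
    ∀ (u : ℝ → E3 → E3) (p : ℝ → E3 → ℝ) (H : ℝ → E3 → E3 →L[ℝ] E3) (c : ℝ≥0) (V : E3 → E3) (P : E3 → ℝ),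
      NeedleData ρ u p H c V P →
        ∃ ε : ℝ, 0 < ε ∧ ∃ c₁ : ℝ, 1 / ((2 + ρ) * (1 + ρ)) < c₁ ∧
          ∀ P' : E3 → ℝ, Literature.Analysis.FluidPDE.IsSelfSimilarEulerProfile (1 / (2 + ρ)) 0 V P' →
            ∀ h : ℝ, ∃ R₀ : ℝ, ∀ y : E3, R₀ ≤ ‖y‖ →
              h < Literature.Analysis.FluidPDE.selfSimilarBernoulli (1 / (2 + ρ)) 0 V P' y →
                Literature.Analysis.FluidPDE.curl V y ≠ 0 → P' y ≤ ε * ‖y‖ ^ 2 →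
                  -(c₁ * ‖y‖ ^ 2) < inner ℝ y (Literature.Analysis.FluidPDE.selfSimilarTransport (1 / (2 + ρ)) 0 V y) →
                    c₁ * ‖y‖ ^ 2 < inner ℝ y (Literature.Analysis.FluidPDE.selfSimilarTransport (1 / (2 + ρ)) 0 V y)

/-- FACE A of `Lines/needle_faces.lean` (T1 ∪ outflow), VERBATIM `NeedleFaces.Sig.stub_swirlFace` — here a DERIVED
statement (`swirlFace_of_dive`), not a stub. -/
def Sig.stub_swirlFace : Prop :=
  ∀ ρ : ℝ, 0 < ρ → ρ ≤ 1 / 2 →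
    ∀ (u : ℝ → E3 → E3) (p : ℝ → E3 → ℝ) (H : ℝ → E3 → E3 →L[ℝ] E3) (c : ℝ≥0) (V : E3 → E3) (P : E3 → ℝ),
      NeedleData ρ u p H c V P →
        ∃ ε : ℝ, 0 < ε ∧ ∃ c₁ : ℝ, 1 / ((2 + ρ) * (1 + ρ)) < c₁ ∧
          ∀ P' : E3 → ℝ, Literature.Analysis.FluidPDE.IsSelfSimilarEulerProfile (1 / (2 + ρ)) 0 V P' →
            ∀ h : ℝ, ∃ R₀ : ℝ, ∀ y : E3, R₀ ≤ ‖y‖ →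
              h < Literature.Analysis.FluidPDE.selfSimilarBernoulli (1 / (2 + ρ)) 0 V P' y →
                Literature.Analysis.FluidPDE.curl V y ≠ 0 → P' y ≤ ε * ‖y‖ ^ 2 →
                  inner ℝ y (Literature.Analysis.FluidPDE.selfSimilarTransport (1 / (2 + ρ)) 0 V y) ≤ -(c₁ * ‖y‖ ^ 2)

/-- FACE B (T2): OPEN. -/
theorem stub_pressureFace : Sig.stub_pressureFace := by
  sorry

/-! ### REV 2: the dive lemma as a three-stub skeleton (prover-ready; composition `outflowDive_of` kernel-checked)
`W y := selfSimilarTransport γ 0 V y`, `ℋ := selfSimilarBernoulli γ 0 V P′`, orbits as explicit `C¹` curves (no flow maps). -/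

/-- Signature of `stub_outflowExit` (D1 — BACKWARD ORBIT UP TO THE FIRST EXIT, pure ODE/topology, M): for a classical profile,
`c₁ > 0`, a floor `R₁ > 0` and a point `y`, `‖y‖ > R₁`, with `⟪y, W y⟫ ≥ c₁‖y‖²`, there are `σ₁ ≥ 0` and a curve `Y` with `Y 0 = y`,
`Y′ = −W(Y)` on `[0, σ₁]`, staying `c₁`-fast outflow with `R₁ ≤ ‖Y σ‖ ≤ ‖y‖` on `[0, σ₁]`, and at `σ₁` EITHER the outflow rate is
exactly at the threshold from above (`⟪Y σ₁, W (Y σ₁)⟫ ≤ c₁‖Y σ₁‖²`) OR the floor is reached (`‖Y σ₁‖ ≤ R₁`).  Proof sketch: maximal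
solution of the `C²` field `−W` from `y` (Picard–Lindelöf; it stays in the compact ball `‖·‖ ≤ ‖y‖` while in outflow mode since
`(‖Y‖²)′ = −2⟪Y, W Y⟫ ≤ −2c₁‖Y‖² ≤ 0`, so it extends); `σ₁ := sup {σ : both closed conditions hold on [0, σ]}` is finite because
`‖Y σ‖ ≤ ‖y‖e^{−c₁σ}` (`BackwardEscape.mul_exp_le_of_deriv_ge`), and at `σ₁` one condition holds with equality by continuity.
TREE NAMES (REV 4 — the whole ODE layer exists; template = the cut-off/uniqueness bookkeeping of
`…Theorems.PowerGaugeEulerLiouville.Loc.volume_vortical_confined_eq_zero`, `Theorems/…SelfSimilarVorticalEscape.lean` l.65–150):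
`…Theorems.PowerGaugeEulerLiouville.Loc.exists_cutoff_local (hU : ContDiff ℝ 2 U) (hR : 0 < R) : ∃ V, ContDiff ℝ 2 V ∧ (∃ M, ∀ y, ‖V y‖ ≤ M) ∧ … ∧
(∃ K, ∀ y, ‖fderiv ℝ V y‖ ≤ K) ∧ ∀ y ∈ ball 0 R, V y = U y` (take `R := ‖y‖ + 1`); the GLOBAL backward orbit of the cut-off field
`Y t := ODE.evolutionMap (fun _ : ℝ => selfSimilarTransport γ 0 Vcut) 0 (−t) y` with
`…Theorems.PowerGaugeEulerLiouville.C2.Kelvin.hasDerivAt_flow_neg (hV : ContDiff ℝ 1 V) (hK) (y) (t) : HasDerivAt (fun r => …evolutionMap … (−r) y)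
((−1 : ℝ) • selfSimilarTransport γ 0 V (…)) t` (ALL `t : ℝ`, so the two-sided `HasDerivAt` at `0` and `σ₁` is free; `(−1 : ℝ) • w = −w` by `neg_one_smul`),
`C2.Kelvin.lipschitzWith_selfSimilarTransport`, `Literature.Analysis.ODE.evolutionMap_self`; while the orbit stays in `closedBall 0 ‖y‖ ⊆ ball 0 (‖y‖+1)` the
two transport fields agree (`selfSimilarTransport_apply`), so the derivative is `−W_U(Y σ)` as stated; `σ₁ := sSup {σ ∈ [0, (1/c₁) log (‖y‖/R₁) + 1] : both closed
conditions on [0, σ]}` (non-empty, bounded; `isClosed` + `csSup_mem`; if both conditions were STRICT at `σ₁` they would persist — contradiction), cf.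
`BackwardEscape.norm_le_mul_exp_of_inflow_ge`-style radial Grönwall for the bound on `σ₁`. -/
def Sig.stub_outflowExit : Prop :=
  ∀ ρ : ℝ, 0 < ρ → ρ ≤ 1 / 2 →
    ∀ (V : E3 → E3) (P' : E3 → ℝ), Literature.Analysis.FluidPDE.IsSelfSimilarEulerProfile (1 / (2 + ρ)) 0 V P' →
      ∀ c₁ : ℝ, 0 < c₁ → ∀ R₁ : ℝ, 0 < R₁ → ∀ y : E3, R₁ < ‖y‖ →
        c₁ * ‖y‖ ^ 2 ≤ inner ℝ y (Literature.Analysis.FluidPDE.selfSimilarTransport (1 / (2 + ρ)) 0 V y) →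
          ∃ σ₁ : ℝ, 0 ≤ σ₁ ∧ ∃ Y : ℝ → E3, Y 0 = y ∧
            (∀ σ ∈ Set.Icc 0 σ₁,
              HasDerivAt Y (-(Literature.Analysis.FluidPDE.selfSimilarTransport (1 / (2 + ρ)) 0 V (Y σ))) σ) ∧
            (∀ σ ∈ Set.Icc 0 σ₁, R₁ ≤ ‖Y σ‖ ∧ ‖Y σ‖ ≤ ‖y‖ ∧
              c₁ * ‖Y σ‖ ^ 2 ≤ inner ℝ (Y σ) (Literature.Analysis.FluidPDE.selfSimilarTransport (1 / (2 + ρ)) 0 V (Y σ))) ∧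
            (inner ℝ (Y σ₁) (Literature.Analysis.FluidPDE.selfSimilarTransport (1 / (2 + ρ)) 0 V (Y σ₁)) ≤ c₁ * ‖Y σ₁‖ ^ 2 ∨
              ‖Y σ₁‖ ≤ R₁)

/-- Signature of `stub_headGain` (D2 — HEAD GAIN ALONG AN OUTFLOW ARC, calculus, S/M): along a `C¹` backward orbit arc `Y′ = −W(Y)`
on `[0, σ₁]` that is `c₁`-fast outflow, `ℋ (Y σ₁) ≥ ℋ (Y 0) + ½(1−2γ)c₁(‖Y 0‖² − ‖Y σ₁‖²)`.  Proof sketch: `(ℋ∘Y)′ = (1−2γ)‖W(Y)‖²`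
((3.31) — TREE NAME `Literature.Analysis.FluidPDE.IsSelfSimilarEulerProfile.fderiv_selfSimilarBernoulli_transport`:
`fderiv ℝ ℋ y (W y) = (2γ−1)‖W y‖²`, differentiability from `IsSelfSimilarEulerProfile.contDiff_selfSimilarBernoulli` (`…/SelfSimilarEulerOutgoingExclusionTools.lean`) or
`hasFDerivAt_selfSimilarBernoulli` (`…/DecayingSelfSimilarEulerProfile.lean`) — + `HasFDerivAt.comp_hasDerivAt` chain rule), `‖W(Y)‖² ≥ ⟪Y, W Y⟫²/‖Y‖² ≥ c₁⟪Y, W Y⟫ =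
−½c₁(‖Y‖²)′` (Cauchy–Schwarz), so `ℋ∘Y + ½(1−2γ)c₁‖Y‖²` is non-decreasing (`1 − 2γ > 0` ⇔ `ρ > 0`).
TREE NAMES (REV 4): the integrated identity IS in the tree for half-orbits —
`…Theorems.PowerGaugeEulerLiouville.HalfOrbit.bernoulli_comp_sub_eq_of_Ici (h : IsSelfSimilarEulerProfile γ c U P) (hYc : Continuous Y)
(hY : ∀ t, 0 ≤ t → HasDerivAt Y (σ • selfSimilarTransport γ c U (Y t)) t) (ha : 0 ≤ a) (hab : a ≤ b) :
ℋ (Y b) − ℋ (Y a) = σ * (2γ − 1) * ∫ t in a..b, ‖selfSimilarTransport γ c U (Y t)‖²` (`Theorems/…SelfSimilarHalfOrbitKit.lean` l.55; its proof uses the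
derivative only on `uIcc a b`, so the `Icc 0 σ₁` variant is a verbatim copy with `σ = −1`); then pointwise on `[0, σ₁]`:
`‖W(Y)‖² ≥ c₁⟪Y, W(Y)⟫` (from `⟪Y, W Y⟫ ≥ c₁‖Y‖² > 0`: `‖W‖ ≥ ⟪Y,W⟫/‖Y‖ ≥ c₁‖Y‖`, `real_inner_le_norm`) and
`∫_0^{σ₁} ⟪Y, W(Y)⟫ = ½(‖Y 0‖² − ‖Y σ₁‖²)` (FTC for `‖Y‖²`, `HasDerivAt.norm_sq` / `hasDerivAt_inner`), `intervalIntegral.integral_mono_on`. Size S given the kit. -/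
def Sig.stub_headGain : Prop :=
  ∀ ρ : ℝ, 0 < ρ → ρ ≤ 1 / 2 →
    ∀ (V : E3 → E3) (P' : E3 → ℝ), Literature.Analysis.FluidPDE.IsSelfSimilarEulerProfile (1 / (2 + ρ)) 0 V P' →
      ∀ c₁ : ℝ, 0 < c₁ → ∀ σ₁ : ℝ, 0 ≤ σ₁ → ∀ Y : ℝ → E3,
        (∀ σ ∈ Set.Icc 0 σ₁,
          HasDerivAt Y (-(Literature.Analysis.FluidPDE.selfSimilarTransport (1 / (2 + ρ)) 0 V (Y σ))) σ) →
        (∀ σ ∈ Set.Icc 0 σ₁,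
          c₁ * ‖Y σ‖ ^ 2 ≤ inner ℝ (Y σ) (Literature.Analysis.FluidPDE.selfSimilarTransport (1 / (2 + ρ)) 0 V (Y σ))) →
        Literature.Analysis.FluidPDE.selfSimilarBernoulli (1 / (2 + ρ)) 0 V P' (Y 0) +
            1 / 2 * (1 - 2 * (1 / (2 + ρ))) * c₁ * (‖Y 0‖ ^ 2 - ‖Y σ₁‖ ^ 2) ≤
          Literature.Analysis.FluidPDE.selfSimilarBernoulli (1 / (2 + ρ)) 0 V P' (Y σ₁)

/-- Signature of `stub_vorticityTransport` (D3 — VORTICITY IS TRANSPORTED ALONG ORBITS, M): along a `C¹` backward orbit arc of `W`,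
`curl V (Y 0) ≠ 0 → curl V (Y σ₁) ≠ 0`.  Proof sketch: the curl of the profile equation is `(W·∇)Ω = (∇V − 1)Ω` (`P′ ∈ C²` because
`∇P′ = −((1−γ)V + γ(y·∇)V + (V·∇)V) ∈ C¹`), so `Ω∘Y` solves a LINEAR ODE with continuous coefficients; uniqueness (Grönwall) gives
`Ω (Y σ₁) = 0 ⇒ Ω (Y 0) = 0`.  TREE NAMES (idea-crit-8 V68 P1 — do not re-derive): the transport identity is
`Literature.Analysis.FluidPDE.IsSelfSimilarEulerProfile.isSelfSimilarEulerVorticityProfile` ((3.3) ⇒ (3.4),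
`Literature/Analysis/FluidPDE/SelfSimilarEulerProfileVorticity.lean`) with
`IsSelfSimilarEulerVorticityProfile.vorticity_eq_transport : curl U y + fderiv ℝ (curl U) y (selfSimilarTransport γ c U y) =
fderiv ℝ U y (curl U y)` and `differentiable_curl_of_contDiff` (so `(Ω∘Y)′ σ = −fderiv ℝ (curl V) (Y σ) (W (Y σ)) =
Ω(Yσ) − DV(Yσ) Ω(Yσ)`, a linear ODE in `Ω∘Y` with coefficient continuous on `[0, σ₁]`; Mathlib `ODE_solution_unique_of_mem_Icc` /
`norm_le_gronwallBound_of_norm_deriv_right_le` against the zero solution). -/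
def Sig.stub_vorticityTransport : Prop :=
  ∀ ρ : ℝ, 0 < ρ → ρ ≤ 1 / 2 →
    ∀ (V : E3 → E3) (P' : E3 → ℝ), Literature.Analysis.FluidPDE.IsSelfSimilarEulerProfile (1 / (2 + ρ)) 0 V P' →
      ∀ σ₁ : ℝ, 0 ≤ σ₁ → ∀ Y : ℝ → E3,
        (∀ σ ∈ Set.Icc 0 σ₁,
          HasDerivAt Y (-(Literature.Analysis.FluidPDE.selfSimilarTransport (1 / (2 + ρ)) 0 V (Y σ))) σ) →
        Literature.Analysis.FluidPDE.curl V (Y 0) ≠ 0 → Literature.Analysis.FluidPDE.curl V (Y σ₁) ≠ 0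

/-- D1 (orbit up to first exit): CLOSED BY NAME (REV 6) — LEAD ns-typeII-p2 g13 `OutflowDive.exists_outflowExit`
(`Theorems/…OutflowDiveExit.lean`, statement verbatim; cut-off flow `Loc.exists_cutoff_local` + first-exit bookkeeping). -/
theorem stub_outflowExit : Sig.stub_outflowExit :=
  Summit.NavierStokesRegularity.NavierStokesRegularity.Theorems.PowerGaugeEulerLiouville.OutflowDive.exists_outflowExit

/-- D2 (head gain along an outflow arc): CLOSED BY NAME (REV 5) — ns-ezl-w1 g5 p664656 `OutflowDive.headGain` (statement verbatim). -/
theorem stub_headGain : Sig.stub_headGain :=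
  Summit.NavierStokesRegularity.NavierStokesRegularity.Theorems.PowerGaugeEulerLiouville.OutflowDive.headGain

/-- D3 (vorticity transport along orbits): CLOSED BY NAME (REV 6) — ns-ezl-w1 g5 p664894 `OutflowDive.vorticityTransport`
(`Theorems/…OutflowDiveVorticityTransport.lean`, statement verbatim; linear Grönwall for `Ω∘Y` along `C¹` arcs, commit 51ce798f2dc0). -/
theorem stub_vorticityTransport : Sig.stub_vorticityTransport :=
  Summit.NavierStokesRegularity.NavierStokesRegularity.Theorems.PowerGaugeEulerLiouville.OutflowDive.vorticityTransport

/-- The Bernoulli function of a classical profile is continuous. -/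
theorem continuous_selfSimilarBernoulli_of_profile {γ : ℝ} {V : E3 → E3} {P' : E3 → ℝ}
    (hprof : Literature.Analysis.FluidPDE.IsSelfSimilarEulerProfile γ 0 V P') :
    Continuous (Literature.Analysis.FluidPDE.selfSimilarBernoulli γ 0 V P') := by
  have hV : Continuous V := hprof.contDiff_velocity.continuous
  have hP : Continuous P' := hprof.contDiff_pressure.continuous
  have : Literature.Analysis.FluidPDE.selfSimilarBernoulli γ 0 V P' =
      fun y => (1 / 2 : ℝ) * ‖γ • (y - 0) + V y‖ ^ 2 + P' y + γ * (γ - 1) / 2 * ‖y - 0‖ ^ 2 := by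
    funext y; exact Literature.Analysis.FluidPDE.selfSimilarBernoulli_apply γ 0 V P' y
  rw [this]
  fun_prop

/-- THE DIVE LEMMA FROM D1–D3 (kernel-checked composition; the only analysis used here is continuity of `ℋ` on a compact ball):
`Sig.stub_outflowDive` ⇐ `stub_outflowExit` ∧ `stub_headGain` ∧ `stub_vorticityTransport`. -/
theorem outflowDive_of (hD1 : Sig.stub_outflowExit) (hD2 : Sig.stub_headGain) (hD3 : Sig.stub_vorticityTransport) :
    Sig.stub_outflowDive := by
  intro ρ hρ hρ' V P' hprof c₁ hc₁ h R₁
  -- friction constant κ = ½(1−2γ)c₁ > 0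
  have hγlt : 1 / (2 + ρ) < 1 / 2 :=
    one_div_lt_one_div_of_lt (by norm_num : (0 : ℝ) < 2) (by linarith : (2 : ℝ) < 2 + ρ)
  set κ : ℝ := 1 / 2 * (1 - 2 * (1 / (2 + ρ))) * c₁ with hκ_def
  have hκ : 0 < κ := by
    have : 0 < 1 - 2 * (1 / (2 + ρ)) := by linarith
    positivity
  -- floor radius R₁' ≥ 1 and a bound M₁ for ℋ on the closed ball of radius R₁'
  set R₁' : ℝ := max R₁ 1 with hR₁'_def
  have hR₁'pos : 0 < R₁' := lt_of_lt_of_le one_pos (le_max_right _ _)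
  have hR₁'1 : 1 ≤ R₁' := le_max_right _ _
  have hcont := continuous_selfSimilarBernoulli_of_profile hprof
  obtain ⟨C, hC⟩ := (isCompact_closedBall (0 : E3) R₁').exists_bound_of_continuousOn hcont.continuousOn
  -- threshold radius
  refine ⟨R₁' + 1 + (|C - h| + 1) / κ, fun y hy hh hcurl hout => ?_⟩
  have hdiv_nonneg : 0 ≤ (|C - h| + 1) / κ := by positivity
  have hyR : R₁' < ‖y‖ := by linarith
  obtain ⟨σ₁, hσ₁, Y, hY0, hYder, hYin, hexit⟩ := hD1 ρ hρ hρ' V P' hprof c₁ hc₁ R₁' hR₁'pos y hyR hout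
  have hgain := hD2 ρ hρ hρ' V P' hprof c₁ hc₁ σ₁ hσ₁ Y hYder (fun σ hσ => (hYin σ hσ).2.2)
  rw [hY0] at hgain
  have hmem : σ₁ ∈ Set.Icc 0 σ₁ := ⟨hσ₁, le_rfl⟩
  obtain ⟨hfloor, hle, hout₁⟩ := hYin σ₁ hmem
  rcases hexit with hex | hfl
  · -- exit at the threshold: y' := Y σ₁
    refine ⟨Y σ₁, le_trans (le_max_left _ _) hfloor, hle, ?_, ?_, ?_, hex⟩
    · -- high: head only grew
      have hsq : 0 ≤ ‖y‖ ^ 2 - ‖Y σ₁‖ ^ 2 := by nlinarith [norm_nonneg (Y σ₁)]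
      have : 0 ≤ κ * (‖y‖ ^ 2 - ‖Y σ₁‖ ^ 2) := mul_nonneg hκ.le hsq
      have hk : κ * (‖y‖ ^ 2 - ‖Y σ₁‖ ^ 2) = 1 / 2 * (1 - 2 * (1 / (2 + ρ))) * c₁ * (‖y‖ ^ 2 - ‖Y σ₁‖ ^ 2) := by
        rw [hκ_def]
      linarith
    · -- vortical: transported
      have := hD3 ρ hρ hρ' V P' hprof σ₁ hσ₁ Y hYder
      rw [hY0] at this
      exact this hcurl
    · -- lower swirl bound: the rate is still ≥ c₁‖y'‖² > −c₁‖y'‖²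
      have hpos : 0 < c₁ * ‖Y σ₁‖ ^ 2 := by
        have : 0 < ‖Y σ₁‖ := lt_of_lt_of_le hR₁'pos hfloor
        positivity
      linarith
  · -- floor reached while still in outflow mode: the head exceeds its bound on the ball — contradiction
    exfalso
    have hYball : Y σ₁ ∈ Metric.closedBall (0 : E3) R₁' := by
      simpa [Metric.mem_closedBall, dist_zero_right] using hfl
    have hCb := hC (Y σ₁) hYball
    have hHle : Literature.Analysis.FluidPDE.selfSimilarBernoulli (1 / (2 + ρ)) 0 V P' (Y σ₁) ≤ C :=
      le_trans (le_abs_self _) (by simpa [Real.norm_eq_abs] using hCb)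
    -- radius bookkeeping: ‖y‖² − ‖Y σ₁‖² ≥ (‖y‖ − R₁')·1 ≥ (|C − h| + 1)/κ
    have hy1 : R₁' + 1 + (|C - h| + 1) / κ ≤ ‖y‖ := hy
    have hdiff : (|C - h| + 1) / κ ≤ ‖y‖ ^ 2 - ‖Y σ₁‖ ^ 2 := by
      have h1 : ‖Y σ₁‖ ^ 2 ≤ R₁' ^ 2 := by nlinarith [norm_nonneg (Y σ₁)]
      have h2 : R₁' ^ 2 + (|C - h| + 1) / κ ≤ ‖y‖ ^ 2 := by nlinarith
      linarith
    have hkd : |C - h| + 1 ≤ κ * (‖y‖ ^ 2 - ‖Y σ₁‖ ^ 2) := by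
      have := mul_le_mul_of_nonneg_left hdiff hκ.le
      rwa [mul_div_cancel₀ _ hκ.ne'] at this
    have hk : κ * (‖y‖ ^ 2 - ‖Y σ₁‖ ^ 2) = 1 / 2 * (1 - 2 * (1 / (2 + ρ))) * c₁ * (‖y‖ ^ 2 - ‖Y σ₁‖ ^ 2) := by
      rw [hκ_def]
    have habs : C - h ≤ |C - h| := le_abs_self _
    linarith

/-- «NO LONG OUTFLOW DIVES» — CLOSED (REV 6): this line's kernel-checked composition `outflowDive_of` over the three tree theorems D1–D3;
`#print axioms` = {propext, Classical.choice, Quot.sound}. -/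
theorem stub_outflowDive : Sig.stub_outflowDive :=
  outflowDive_of stub_outflowExit stub_headGain stub_vorticityTransport

/-- Second, independent witness (REV 6): the LEAD's own assembly `OutflowDive.outflowDive` (`Theorems/…OutflowDive.lean`, ns-typeII-p2 g13)
proves the same statement verbatim. -/
theorem stub_outflowDive' : Sig.stub_outflowDive :=
  Summit.NavierStokesRegularity.NavierStokesRegularity.Theorems.PowerGaugeEulerLiouville.OutflowDive.outflowDive

/-- FACE A′ (T1 proper, symmetry-free): OPEN. -/
theorem stub_swirlRangeFace : Sig.stub_swirlRangeFace := by
  sorry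

/-- OUTFLOW IS NOT A FACE: the dive lemma, T1 proper and T2 give FACE A of `needle_faces` (pure logic on top of the
three statements: a far `ε`-unpressurised vortical high point that is not `c₁`-fast inflow is in the swirl range —
excluded by A′ — or a `c₁`-fast outflow point, whose dive partner `y′` (radius `≥ R₁ := max R_{A′} R_B`) is vortical,
high, unpressurised by B and in the swirl range — excluded by A′ again). -/
theorem swirlFace_of_dive (hDv : Sig.stub_outflowDive) (hA : Sig.stub_swirlRangeFace) (hB : Sig.stub_pressureFace) :
    Sig.stub_swirlFace := by
  intro ρ hρ hρ' u p H c V P hD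
  obtain ⟨ε, hε, c₁, hc₁, hAc⟩ := hA ρ hρ hρ' u p H c V P hD
  have hc₁pos : 0 < c₁ := lt_trans (by positivity) hc₁
  refine ⟨ε, hε, c₁, hc₁, fun P' hP' h => ?_⟩
  obtain ⟨RA, hRA⟩ := hAc P' hP' h
  obtain ⟨RB, hRB⟩ := hB ρ hρ hρ' u p H c V P hD ε hε P' hP' h
  obtain ⟨R₂, hR₂⟩ := hDv ρ hρ hρ' V P' hP' c₁ hc₁pos h (max RA RB)
  refine ⟨max (max RA RB) R₂, fun y hy hh hcurl hPy => ?_⟩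
  have hyA : RA ≤ ‖y‖ := le_trans (le_trans (le_max_left _ _) (le_max_left _ _)) hy
  have hy2 : R₂ ≤ ‖y‖ := le_trans (le_max_right _ _) hy
  by_contra hnot
  have hlow : -(c₁ * ‖y‖ ^ 2) < inner ℝ y (Literature.Analysis.FluidPDE.selfSimilarTransport (1 / (2 + ρ)) 0 V y) :=
    lt_of_not_ge hnot
  rcases le_or_gt (inner ℝ y (Literature.Analysis.FluidPDE.selfSimilarTransport (1 / (2 + ρ)) 0 V y)) (c₁ * ‖y‖ ^ 2)
    with hle | hgt
  · exact absurd (hRA y hyA hh hcurl hPy hlow) (not_lt.mpr hle)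
  · obtain ⟨y', hy'1, -, hh', hcurl', hlow', hle'⟩ := hR₂ y hy2 hh hcurl (le_of_lt hgt)
    have hy'A : RA ≤ ‖y'‖ := le_trans (le_max_left _ _) hy'1
    have hy'B : RB ≤ ‖y'‖ := le_trans (le_max_right _ _) hy'1
    have hPy' : P' y' ≤ ε * ‖y'‖ ^ 2 := hRB y' hy'B hh' hcurl'
    exact absurd (hRA y' hy'A hh' hcurl' hPy' hlow') (not_lt.mpr hle')

/-- FACE A and FACE B close THE ONE STATEMENT (pure logic, as in `NeedleFaces.selfSimilarC2Needle_of_faces`: A and B at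
the same `ε` give the fast vortical channel at A's rate, contradicting `¬ HasFastVorticalChannel`). -/
theorem selfSimilarC2Needle_of_swirlFace (hA : Sig.stub_swirlFace) (hB : Sig.stub_pressureFace) :
    Sig.stub_selfSimilarC2Needle := by
  intro ρ hρ hρ' u p H c V P hcls hss hext hC2 hnp hntame hnch hnclock hnaxis
  have hD : NeedleData ρ u p H c V P := ⟨hcls, hss, hext, hC2, hnp, hntame, hnclock, hnaxis⟩
  obtain ⟨ε, hε, c₁, hc₁, hAc⟩ := hA ρ hρ hρ' u p H c V P hD
  exfalso
  apply hnch
  refine Or.inl ⟨c₁, lt_trans (by positivity) hc₁, fun P' hP' h => ?_⟩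
  obtain ⟨RA, hRA⟩ := hAc P' hP' h
  obtain ⟨RB, hRB⟩ := hB ρ hρ hρ' u p H c V P hD ε hε P' hP' h
  exact ⟨max RA RB, fun y hy hh hcurl =>
    hRA y (le_trans (le_max_left _ _) hy) hh hcurl (hRB y (le_trans (le_max_right _ _) hy) hh hcurl)⟩

/-- Audit form with the stubs in place: THE ONE STATEMENT from the registered stubs of this line. -/
theorem selfSimilarC2Needle_of :
    Sig.stub_outflowDive → Sig.stub_swirlRangeFace → Sig.stub_pressureFace → Sig.stub_selfSimilarC2Needle :=
  fun hDv hA hB => selfSimilarC2Needle_of_swirlFace (swirlFace_of_dive hDv hA hB) hB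


/-! ## REV 7/8 — COROLLARIES for the LEAD: «THE NEEDLE LIVES IN THE SWIRL BAND — INDEED IN THE SLOW BAND» (tree theorems by name) -/

/-- **«¬channel ⇒ swirl-band points at EVERY rate»** (REV 8: by name — ns-ezl-w3 g5 p669403 `Theorems/…OutflowDiveSwirlBand.lean`,
commit 4de1a9658f8e, `OutflowDive.swirlBand_of_not_channel_above` with threshold `0`; REV 7 had the in-file proof at the old threshold).  For every
`C²`-free statement: a similarity profile `V` with `ρ ∈ (0, ½]` and NO fast vortical channel (v83: at ANY rate) has, for every rate `c₁ > 0`, a profile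
pressure `P′` and a level `h` with, beyond EVERY radius, a Bernoulli-high vortical point IN THE BAND `−c₁‖y‖² < ⟪y, W y⟫ ≤ c₁‖y‖²`
(¬channel's non-inflow witnesses; the `c₁`-fast OUTFLOW ones are sent to band points below them by the closed Dive).  No sorry. -/
theorem swirlBand_of_not_channel (ρ : ℝ) (hρ : 0 < ρ) (hρh : ρ ≤ 1 / 2) (V : E3 → E3)
    (hV : ¬ HasFastVorticalChannel ρ V) :
    ∀ c₁ : ℝ, 0 < c₁ →
      ∃ P' : E3 → ℝ, Literature.Analysis.FluidPDE.IsSelfSimilarEulerProfile (1 / (2 + ρ)) 0 V P' ∧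
        ∃ h : ℝ, ∀ R₀ : ℝ, ∃ y : E3, R₀ ≤ ‖y‖ ∧
          h < Literature.Analysis.FluidPDE.selfSimilarBernoulli (1 / (2 + ρ)) 0 V P' y ∧
          Literature.Analysis.FluidPDE.curl V y ≠ 0 ∧
          -(c₁ * ‖y‖ ^ 2) < inner ℝ y (Literature.Analysis.FluidPDE.selfSimilarTransport (1 / (2 + ρ)) 0 V y) ∧
          inner ℝ y (Literature.Analysis.FluidPDE.selfSimilarTransport (1 / (2 + ρ)) 0 V y) ≤ c₁ * ‖y‖ ^ 2 :=
  Summit.NavierStokesRegularity.NavierStokesRegularity.Theorems.PowerGaugeEulerLiouville.OutflowDive.swirlBand_of_not_channel_above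
    ρ hρ hρh V 0 le_rfl (fun h => hV (Or.inl h))

/-- **«THE NEEDLE LIVES IN THE SLOW BAND»** (REV 8, by name: `OutflowDive.slowBand_of_not_channel`, same file): under `¬ HasFastVorticalChannel`
(v83), for every `c₁ > 0` some profile pressure and level admit, beyond every radius, a Bernoulli-high vortical point with RADIAL RATE
`|⟪y, W y⟫| ≤ c₁‖y‖²` — the residual needle consists of radially-slow high vortical points: pure swirl (tangential speed ≈ √(γ(1−γ) − 2ε)·‖y‖
when `ε`-unpressurised: face A′) or parked / pressurised cores (faces B, B♯; line `needle_faces` L/L♯).  No sorry. -/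
theorem slowBand_of_not_channel (ρ : ℝ) (hρ : 0 < ρ) (hρh : ρ ≤ 1 / 2) (V : E3 → E3)
    (hV : ¬ HasFastVorticalChannel ρ V) :
    ∀ c₁ : ℝ, 0 < c₁ →
      ∃ P' : E3 → ℝ, Literature.Analysis.FluidPDE.IsSelfSimilarEulerProfile (1 / (2 + ρ)) 0 V P' ∧
        ∃ h : ℝ, ∀ R₀ : ℝ, ∃ y : E3, R₀ ≤ ‖y‖ ∧
          h < Literature.Analysis.FluidPDE.selfSimilarBernoulli (1 / (2 + ρ)) 0 V P' y ∧
          Literature.Analysis.FluidPDE.curl V y ≠ 0 ∧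
          |inner ℝ y (Literature.Analysis.FluidPDE.selfSimilarTransport (1 / (2 + ρ)) 0 V y)| ≤ c₁ * ‖y‖ ^ 2 :=
  Summit.NavierStokesRegularity.NavierStokesRegularity.Theorems.PowerGaugeEulerLiouville.OutflowDive.slowBand_of_not_channel ρ hρ hρh V
    (fun h => hV (Or.inl h))

end Summit.NavierStokesRegularity.NavierStokesRegularity.Cruxes.PowerGaugeEulerLiouville.OutflowDive
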